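import Summits.NavierStokesRegularity.FunctionalMining.VorticityL4SaturatingLaw
import Summits.NavierStokesRegularity.FunctionalMining.SaturatingLawTransport
import Summits.NavierStokesRegularity.FunctionalMining.PalinstrophyLadderProofs
import Summits.NavierStokesRegularity.FunctionalMining.SaturatingLawLyapunov

/-!
# Rows `EK.E.q=2|T_M0`, `EK.E.q=4|T_M0`, `EK.EF.s=2|T_M0`: moment Lyapunov functionals

Search for candidate a priori estimates; no regularity claim.

The K0 matrix books the saturating-Lyapunov rows `EK.*|T_M0`
(`M_F(κ) = K − (σ/κ) ν^{γ+1} F^{−1/σ}` antitone along every solution, `K = ½‖u‖₂²`) as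
"HOLDS ∃κ (inherited)" from the corresponding saturating-law row `F|T_LD|G1`
(`dF/dt ≤ κ ν^{−γ} (2ℰ) F^{1+1/σ}`, `Candidates.SaturatingLaw`). The inheritance `T_LD ⟹ T_M0` is the
tree lemma `SaturatingLaw.antitoneOn_lyapunov`; this file composes it with three tree laws, so that
the following rows are filed instances (kernel statements on positive-`F` windows):

* `EK.E.q=2|T_M0` — `F = Z₂ = ∫|ω|²`, `σ = 1`, `γ = 3`, explicit `κ = 27/(32π⁴)`
  (`vorticityMoment_two_saturatingLaw`, the Lu–Doering law transported along `Z₂ = 2ℰ`):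
  `K − (32π⁴/27) ν⁴ Z₂⁻¹` antitone — the Ayala–Protas form.
* `EK.E.q=4|T_M0` — `F = Z₄ = ∫|ω|⁴` on `T³ = UnitAddTorus (Fin 3)`, `σ = 5`, `γ = 9/5`
  (`VorticityL4.vorticityL4_saturatingLaw`): `∃ κ > 0`, `K − (5/κ) ν^{14/5} Z₄^{−1/5}` antitone.
* `EK.EF.s=2|T_M0` — `F = 𝒫 = ‖Δu‖₂²`, `σ = 3`, `γ = 5/3`, explicit `κ = κ_A`
  (`palinstrophySaturatingLaw_ladderConst`): `K − (3/κ_A) ν^{8/3} 𝒫^{−1/3}` antitone.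

## Main statements

* `vorticityMoment_two_lyapunov_antitoneOn` — row `EK.E.q=2|T_M0`.
* `VorticityL4.lyapunov_antitoneOn` — row `EK.E.q=4|T_M0`.
* `palinstrophyLadderConst_pos`, `palinstrophy_lyapunov_antitoneOn` — row `EK.EF.s=2|T_M0`.
-/

noncomputable section

open MeasureTheory Set

namespace Summit.NavierStokesRegularity.FunctionalMining

open Literature.Analysis.FunctionSpaces Literature.Analysis.FluidPDE

variable {d : Type*} [Fintype d] [DecidableEq d]

/-- **Row `EK.E.q=2|T_M0` (kernel, explicit constant).** Along every zero-mean classical solution of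
unforced Navier–Stokes on `T³ × [a, b]` with `Z₂(u t) = ∫|ω|² > 0` on the window,
`t ↦ K(u t) − (32π⁴/27) ν⁴ Z₂(u t)⁻¹` is antitone on `[a, b]` — from
`vorticityMoment_two_saturatingLaw` (`σ = 1`, `γ = 3`, `κ = 27/(32π⁴)`) and
`SaturatingLaw.antitoneOn_lyapunov`; the Ayala–Protas Lyapunov form of the Lu–Doering law.
Search for candidate a priori estimates; no regularity claim. [folklore] -/
theorem vorticityMoment_two_lyapunov_antitoneOn (hd : Fintype.card d = 3) {ν a b : ℝ}
    (hν : 0 < ν) (hab : a < b)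
    {u : ℝ → UnitAddTorus d → EuclideanSpace ℝ d} {p : ℝ → UnitAddTorus d → ℝ}
    (hsol : Torus.IsClassicalNSSolutionOn (Icc a b) ν 0 u p)
    (hmean : ∀ t ∈ Icc a b, Torus.HasZeroMean (u t))
    (hpos : ∀ t ∈ Icc a b, 0 < torusVorticityMoment 2 (u t)) :
    AntitoneOn (fun t => Torus.kineticEnergy (u t) -
        32 * Real.pi ^ 4 / 27 * ν ^ (4 : ℝ) * (torusVorticityMoment 2 (u t))⁻¹) (Icc a b) := by
  have hκ : (0 : ℝ) < 27 / (32 * Real.pi ^ 4) := by positivity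
  have h := (vorticityMoment_two_saturatingLaw (d := d)).antitoneOn_lyapunov one_pos hκ hd hν hab
    hsol hmean hpos
  have hγ : (3 : ℝ) + 1 = 4 := by norm_num
  have hc : (1 : ℝ) / (27 / (32 * Real.pi ^ 4)) = 32 * Real.pi ^ 4 / 27 := by
    field_simp
  refine h.congr fun t _ => ?_
  simp only [hγ, inv_one, Real.rpow_neg_one, hc]

/-- **Row `EK.E.q=4|T_M0` (kernel), on `T³ = UnitAddTorus (Fin 3)`.** There is `κ > 0` such that
along every zero-mean classical solution of unforced Navier–Stokes on `T³ × [a, b]` with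
`Z₄(u t) = ∫|ω|⁴ > 0` on the window, `t ↦ K(u t) − (5/κ) ν^{14/5} Z₄(u t)^{−1/5}` is antitone on
`[a, b]` — from `VorticityL4.vorticityL4_saturatingLaw` (`σ = 5`, `γ = 9/5`; `κ` raised to
`max κ 1 > 0` by `SaturatingLaw.mono_kappa`) and `SaturatingLaw.antitoneOn_lyapunov`.
Search for candidate a priori estimates; no regularity claim. [folklore] -/
theorem VorticityL4.lyapunov_antitoneOn :
    ∃ κ : ℝ, 0 < κ ∧ ∀ {ν a b : ℝ}, 0 < ν → a < b →
      ∀ {u : ℝ → UnitAddTorus (Fin 3) → EuclideanSpace ℝ (Fin 3)}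
        {p : ℝ → UnitAddTorus (Fin 3) → ℝ},
        Torus.IsClassicalNSSolutionOn (Icc a b) ν 0 u p →
        (∀ t ∈ Icc a b, Torus.HasZeroMean (u t)) →
        (∀ t ∈ Icc a b, 0 < torusVorticityMoment 4 (u t)) →
        AntitoneOn (fun t => Torus.kineticEnergy (u t) -
            5 / κ * ν ^ (14 / 5 : ℝ) * torusVorticityMoment 4 (u t) ^ (-(1 / 5 : ℝ))) (Icc a b) := by
  obtain ⟨κ₀, hκ₀⟩ := VorticityL4.vorticityL4_saturatingLaw
  have hF0 : ∀ v : UnitAddTorus (Fin 3) → EuclideanSpace ℝ (Fin 3), 0 ≤ torusVorticityMoment 4 v :=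
    fun v => torusVorticityMoment_nonneg 4 v
  have hlaw : SaturatingLaw (d := Fin 3) (torusVorticityMoment 4) 5 (9 / 5) (max κ₀ 1) :=
    hκ₀.mono_kappa hF0 (le_max_left _ _)
  have hκ : 0 < max κ₀ 1 := lt_of_lt_of_le one_pos (le_max_right _ _)
  refine ⟨max κ₀ 1, hκ, fun hν hab u p hsol hmean hpos => ?_⟩
  have h := hlaw.antitoneOn_lyapunov (by norm_num) hκ (by simp) hν hab hsol hmean hpos
  have hγ : (9 / 5 : ℝ) + 1 = 14 / 5 := by norm_num
  have hσ : -(5 : ℝ)⁻¹ = -(1 / 5 : ℝ) := by norm_num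
  refine h.congr fun t _ => ?_
  simp only [hγ, hσ]

/-- The palinstrophy ladder constant `κ_A = (3/256)(5/2)^{5/3}(6√2/π)^{8/3}` is positive. [folklore] -/
theorem palinstrophyLadderConst_pos : 0 < palinstrophyLadderConst := by
  unfold palinstrophyLadderConst
  have h1 : (0 : ℝ) < (5 / 2 : ℝ) ^ (5 / 3 : ℝ) := Real.rpow_pos_of_pos (by norm_num) _
  have h2 : (0 : ℝ) < (6 * (Real.sqrt 2 / Real.pi)) ^ (8 / 3 : ℝ) :=
    Real.rpow_pos_of_pos (by positivity) _
  positivity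

/-- **Row `EK.EF.s=2|T_M0` (kernel, explicit constant).** Along every zero-mean classical solution
of unforced Navier–Stokes on `T³ × [a, b]` with `𝒫(u t) = ‖Δu‖₂² > 0` on the window,
`t ↦ K(u t) − (3/κ_A) ν^{8/3} 𝒫(u t)^{−1/3}` is antitone on `[a, b]`, `κ_A = palinstrophyLadderConst`
— from `palinstrophySaturatingLaw_ladderConst` (`σ = 3`, `γ = 5/3`) and
`SaturatingLaw.antitoneOn_lyapunov`. Search for candidate a priori estimates; no regularity claim.
[folklore] -/
theorem palinstrophy_lyapunov_antitoneOn (hd : Fintype.card d = 3) {ν a b : ℝ}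
    (hν : 0 < ν) (hab : a < b)
    {u : ℝ → UnitAddTorus d → EuclideanSpace ℝ d} {p : ℝ → UnitAddTorus d → ℝ}
    (hsol : Torus.IsClassicalNSSolutionOn (Icc a b) ν 0 u p)
    (hmean : ∀ t ∈ Icc a b, Torus.HasZeroMean (u t))
    (hpos : ∀ t ∈ Icc a b, 0 < torusPalinstrophy (u t)) :
    AntitoneOn (fun t => Torus.kineticEnergy (u t) -
        3 / palinstrophyLadderConst * ν ^ (8 / 3 : ℝ) * torusPalinstrophy (u t) ^ (-(1 / 3 : ℝ)))
      (Icc a b) := by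
  have hlaw : SaturatingLaw (d := d) torusPalinstrophy 3 (5 / 3) palinstrophyLadderConst :=
    palinstrophySaturatingLaw_ladderConst
  have h := hlaw.antitoneOn_lyapunov (by norm_num) palinstrophyLadderConst_pos hd hν hab hsol
    hmean hpos
  have hγ : (5 / 3 : ℝ) + 1 = 8 / 3 := by norm_num
  have hσ : -(3 : ℝ)⁻¹ = -(1 / 3 : ℝ) := by norm_num
  refine h.congr fun t _ => ?_
  simp only [hγ, hσ]

end Summit.NavierStokesRegularity.FunctionalMining
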